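import Summits.AtomisticToContinuum.BoseEinsteinCondensation.Theses.BECInfraredBound
import Literature.MathematicalPhysics.QuantumManyBody.PeriodicBoseGasFracEnergy
import Literature.MathematicalPhysics.QuantumManyBody.OneParticleMarginals
import Literature.MathematicalPhysics.QuantumManyBody.BoseGasMergeOccupation
import Literature.MathematicalPhysics.QuantumManyBody.LiebYngvasonBoxBound
import Literature.MathematicalPhysics.QuantumManyBody.DyadicCoherentFractionRefinement
import Literature.MathematicalPhysics.QuantumManyBody.NeumannMomentumCutoffs
import Literature.MathematicalPhysics.QuantumManyBody.BoseGasProductState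

/-!
# Candidate proof of the crux `BECInfraredBound.BecDepletionCounting` (stmt-AtomisticToContinuum-9034)
# along the crux idea `translate-traced-parseval` (ideator k=2, round 1).

Part 1 = LineProofs.lean (lever + free-spectator traced Parseval + inner-cube sum rule),
Part 2 = TransferProof.lean (fibrewise parallelogram shell transfer),
Part 3 = composition: a.e. Ioo/Ico swap for the DEPL modes, `k = 0` split, Bose symmetry for the shell,
mass split, real arithmetic (birth's `zeroMode_lower_arith` with `12εN`), filter assembly (birth's
`BecDepletionCounting_of` pattern) — concluding the route decl BY NAME.
-/

/-!
# Line proofs — crux idea `translate-traced-parseval` (stmt-AtomisticToContinuum-9034, ideator k=2)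

Everything here is PROVED (no `sorry`): the lever `occupation_translate`, the phase lemma, the
free-spectator traced Parseval on the origin cell, the re-anchoring of the crux's literal inner-cube
modes, and the inner-cube sum rule over all `k ∈ ℤ³` in the crux's literal mode family (half-open cube).
-/

noncomputable section

open MeasureTheory Complex WithLp
open scoped ENNReal NNReal ComplexConjugate BigOperators

namespace Summit.AtomisticToContinuum.BoseEinsteinCondensation.Cruxes.BecDepletionCounting.TranslateTracedParseval

open Literature.MathematicalPhysics.QuantumManyBody.BoseGas

/-- `(x :: Y) - a⃗ = (x - a) :: (Y - a⃗)`. -/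
theorem vecCons_sub_const {n : ℕ} (x a : Space) (Y : Config n) :
    (Matrix.vecCons x Y - fun _ => a) = Matrix.vecCons (x - a) (Y - fun _ => a) := by
  ext i
  refine Fin.cases ?_ (fun j => ?_) i
  · simp
  · simp

/-- FIRST LEMMA (the lever), PROVED: occupations are jointly translation invariant. -/
theorem occupation_translate (N : ℕ) (φ : Space → ℂ) (Ψ : Config N → ℂ) (a : Space) :
    occupation N (fun x => φ (x - a)) (fun X => Ψ (X - fun _ => a)) = occupation N φ Ψ := by
  cases N with
  | zero => rfl
  | succ n =>
    simp only [occupation]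
    congr 1
    have hinner : ∀ Y : Config n,
        ∫ x, conj (φ (x - a)) * Ψ (Matrix.vecCons x Y - fun _ => a) =
          ∫ x, conj (φ x) * Ψ (Matrix.vecCons x (Y - fun _ => a)) := by
      intro Y
      simp_rw [vecCons_sub_const]
      exact integral_sub_right_eq_self
        (fun x => conj (φ x) * Ψ (Matrix.vecCons x (Y - fun _ => a))) a
    simp_rw [hinner]
    exact lintegral_sub_right_eq_self (μ := (volume : Measure (Config n)))
      (fun Y => (‖∫ x, conj (φ x) * Ψ (Matrix.vecCons x Y)‖₊ : ℝ≥0∞) ^ 2) (fun _ => a)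

/-- A unit phase on the MODE does not change the occupation. -/
theorem occupation_phase_mul_mode (N : ℕ) (φ : Space → ℂ) (Ψ : Config N → ℂ) {c : ℂ} (hc : ‖c‖ = 1) :
    occupation N (fun x => c * φ x) Ψ = occupation N φ Ψ := by
  cases N with
  | zero => rfl
  | succ n =>
    simp only [occupation]
    congr 1
    refine lintegral_congr fun Y => ?_
    have : ∫ x, conj (c * φ x) * Ψ (Matrix.vecCons x Y) =
        conj c * ∫ x, conj (φ x) * Ψ (Matrix.vecCons x Y) := by
      rw [← integral_const_mul]
      refine integral_congr_ae (Filter.Eventually.of_forall fun x => ?_)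
      simp only [map_mul]
      ring
    rw [this, nnnorm_mul]
    have hc' : ‖conj c‖₊ = 1 := by
      apply NNReal.coe_injective
      rw [coe_nnnorm, Complex.norm_conj, hc, NNReal.coe_one]
    rw [hc', one_mul]


/-- Pairing with an indicator-cut mode = restricted pairing. -/
theorem integral_conj_indicator_mul {s : Set Space} (hs : MeasurableSet s) (φ G : Space → ℂ) :
    ∫ x, conj (s.indicator φ x) * G x = ∫ x in s, conj (φ x) * G x := by
  rw [← integral_indicator hs]
  refine integral_congr_ae (Filter.Eventually.of_forall fun x => ?_)
  by_cases hx : x ∈ s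
  · simp [Set.indicator_of_mem hx]
  · simp [Set.indicator_of_notMem hx]

/-- FREE-SPECTATOR traced Parseval on the origin cell (spectators range over all of `Config n`). -/
theorem tsum_occupation_cellMode_eq {n : ℕ} {L : ℝ} (hL : 0 < L) {Ψ : Config (n + 1) → ℂ}
    (hΨ : Continuous Ψ) :
    ∑' p : Fin 3 → ℤ, occupation (n + 1) ((cell L).indicator (planeWaveMode L p)) Ψ =
      ((n : ℝ≥0∞) + 1) *
        ∫⁻ X : Config (n + 1), (cell L).indicator (fun _ => (1 : ℝ≥0∞)) (X 0) * (‖Ψ X‖₊ : ℝ≥0∞) ^ 2 := by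
  have hL3 : ENNReal.ofReal L ^ 3 ≠ 0 := pow_ne_zero _ (by simpa using hL)
  have hL3' : ENNReal.ofReal L ^ 3 ≠ ⊤ := ENNReal.pow_ne_top ENNReal.ofReal_ne_top
  have hslice : ∀ Y : Config n, Continuous fun x => Ψ (Matrix.vecCons x Y) := fun Y =>
    hΨ.comp (continuous_id.matrixVecCons continuous_const)
  have hocc : ∀ p, occupation (n + 1) ((cell L).indicator (planeWaveMode L p)) Ψ =
      (n + 1 : ℝ≥0∞) * ∫⁻ Y : Config n,
        (‖∫ x in cell L, conj (planeWaveMode L p x) * Ψ (Matrix.vecCons x Y)‖₊ : ℝ≥0∞) ^ 2 := by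
    intro p
    simp only [occupation]
    simp_rw [integral_conj_indicator_mul (measurableSet_cell L)]
  simp_rw [hocc]
  rw [ENNReal.tsum_mul_left, ← lintegral_tsum fun p =>
    (measurable_sliceInner (continuous_planeWaveMode L p) hΨ).aemeasurable]
  have hfib : ∀ Y : Config n,
      ∑' p : Fin 3 → ℤ,
          (‖∫ x in cell L, conj (planeWaveMode L p x) * Ψ (Matrix.vecCons x Y)‖₊ : ℝ≥0∞) ^ 2 =
        ∫⁻ x in cell L, (‖Ψ (Matrix.vecCons x Y)‖₊ : ℝ≥0∞) ^ 2 := by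
    intro Y
    simp only [nnnorm_sq_integral_conj_planeWaveMode_mul hL]
    rw [ENNReal.tsum_mul_left, tsum_sq_cellFourierCoeff hL (hslice Y), ← mul_assoc,
      ENNReal.mul_inv_cancel hL3 hL3', one_mul]
  simp_rw [hfib]
  have hF : Measurable fun X : Config (n + 1) =>
      (cell L).indicator (fun _ => (1 : ℝ≥0∞)) (X 0) * (‖Ψ X‖₊ : ℝ≥0∞) ^ 2 := by
    refine Measurable.mul ?_ (hΨ.measurable.nnnorm.coe_nnreal_ennreal.pow_const _)
    exact (measurable_const.indicator (measurableSet_cell L)).comp (measurable_pi_apply 0)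
  have hAE : AEMeasurable (Function.uncurry fun (x : Space) (Y : Config n) =>
      (cell L).indicator (fun _ => (1 : ℝ≥0∞)) ((Matrix.vecCons x Y : Config (n + 1)) 0) *
        (‖Ψ (Matrix.vecCons x Y)‖₊ : ℝ≥0∞) ^ 2) (volume.prod volume) :=
    (hF.comp measurable_vecCons).aemeasurable
  have key : ∫⁻ X : Config (n + 1), (cell L).indicator (fun _ => (1 : ℝ≥0∞)) (X 0) * (‖Ψ X‖₊ : ℝ≥0∞) ^ 2
      = ∫⁻ Y : Config n, ∫⁻ x in cell L, (‖Ψ (Matrix.vecCons x Y)‖₊ : ℝ≥0∞) ^ 2 := by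
    rw [← lintegral_lintegral_vecCons hF, lintegral_lintegral_swap hAE]
    refine lintegral_congr fun Y => ?_
    rw [← lintegral_indicator (measurableSet_cell L)]
    refine lintegral_congr fun x => ?_
    simp only [Matrix.cons_val_zero]
    by_cases hx : x ∈ cell L
    · simp [Set.indicator_of_mem hx]
    · simp [Set.indicator_of_notMem hx]
  rw [key]


/-! ### Re-anchoring the inner cube at the origin -/

/-- The constant shift vector `t·𝟙 ∈ ℝ³`. -/
def shiftVec (t : ℝ) : Space := toLp 2 fun _ => t

@[simp] theorem shiftVec_apply (t : ℝ) (j : Fin 3) : shiftVec t j = t := by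
  simp [shiftVec]

/-- The half-open inner cube `∏ [εL, L-εL)` is the translate by `εL·𝟙` of the cell of side `(1-2ε)L`. -/
theorem mem_innerIco_iff {L ε : ℝ} (x : Space) :
    (∀ j, x j ∈ Set.Ico (ε * L) (L - ε * L)) ↔ x - shiftVec (ε * L) ∈ cell ((1 - 2 * ε) * L) := by
  simp only [cell, Set.mem_setOf_eq, Set.mem_Ico, PiLp.sub_apply, shiftVec_apply]
  refine forall_congr' fun j => ?_
  constructor <;> rintro ⟨h1, h2⟩ <;> constructor <;> linarith

/-- The crux's literal inner-cube plane wave of index `k` (half-open cube) is a unit phase times the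
translated cell mode `1_cell φ_k (· - εL·𝟙)` of side `(1-2ε)L`. Pointwise, no null sets. -/
theorem innerMode_eq {L ε : ℝ} (k : Fin 3 → ℤ) :
    ({x : Space | ∀ j, x j ∈ Set.Ico (ε * L) (L - ε * L)}.indicator fun x =>
        ((Real.sqrt (((1 - 2 * ε) * L) ^ 3))⁻¹ : ℂ) *
          Complex.exp (Complex.I * ↑(2 * Real.pi / ((1 - 2 * ε) * L) * ∑ j, (k j : ℝ) * x j))) =
      fun x => Complex.exp (↑(2 * Real.pi / ((1 - 2 * ε) * L) * ∑ j, (k j : ℝ) * (ε * L)) * Complex.I) *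
        (cell ((1 - 2 * ε) * L)).indicator (planeWaveMode ((1 - 2 * ε) * L) k) (x - shiftVec (ε * L)) := by
  funext x
  by_cases hx : ∀ j, x j ∈ Set.Ico (ε * L) (L - ε * L)
  · have hx' : x - shiftVec (ε * L) ∈ cell ((1 - 2 * ε) * L) := (mem_innerIco_iff x).1 hx
    rw [Set.indicator_of_mem (show x ∈ {x : Space | ∀ j, x j ∈ Set.Ico (ε * L) (L - ε * L)} from hx),
      Set.indicator_of_mem hx']
    simp only [planeWaveMode, PiLp.sub_apply, shiftVec_apply]
    conv_rhs => rw [mul_left_comm, ← Complex.exp_add]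
    congr 1
    congr 1
    push_cast
    simp only [mul_sub, Finset.sum_sub_distrib]
    ring
  · have hx' : x - shiftVec (ε * L) ∉ cell ((1 - 2 * ε) * L) := fun h => hx ((mem_innerIco_iff x).2 h)
    rw [Set.indicator_of_notMem (show x ∉ {x : Space | ∀ j, x j ∈ Set.Ico (ε * L) (L - ε * L)} from hx),
      Set.indicator_of_notMem hx', mul_zero]

/-- INNER-CUBE SUM RULE over all `k ∈ ℤ³` in the crux's literal mode family (half-open cube
`S = ∏[εL, L-εL)`; the crux's open cube differs from `S` by a null set, handled once downstream by
`occupation_congr_ae` for the modes and by monotonicity `1_{Sᶜ} ≤ 1_{Λ'ᶜ}` for the shell):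
`∑_k ⟨φ'_k, γ_Ψ φ'_k⟩ = (n+1) ∫ 1_S(x₀) |Ψ(X)|² dX` for every continuous `(n+1)`-body `Ψ`. -/
theorem tsum_occupation_innerMode_eq {n : ℕ} {L ε : ℝ} (hL : 0 < L) (hε4 : ε < 1 / 2)
    {Ψ : Config (n + 1) → ℂ} (hΨ : Continuous Ψ) :
    ∑' k : Fin 3 → ℤ, occupation (n + 1)
        ({x : Space | ∀ j, x j ∈ Set.Ico (ε * L) (L - ε * L)}.indicator fun x =>
          ((Real.sqrt (((1 - 2 * ε) * L) ^ 3))⁻¹ : ℂ) *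
            Complex.exp (Complex.I * ↑(2 * Real.pi / ((1 - 2 * ε) * L) * ∑ j, (k j : ℝ) * x j))) Ψ =
      ((n : ℝ≥0∞) + 1) *
        ∫⁻ X : Config (n + 1),
          {x : Space | ∀ j, x j ∈ Set.Ico (ε * L) (L - ε * L)}.indicator
            (fun _ => (1 : ℝ≥0∞)) (X 0) * (‖Ψ X‖₊ : ℝ≥0∞) ^ 2 := by
  have hL' : 0 < (1 - 2 * ε) * L := mul_pos (by linarith) hL
  have hΨ'c : Continuous fun X : Config (n + 1) => Ψ (X + fun _ => shiftVec (ε * L)) :=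
    hΨ.comp (continuous_id.add continuous_const)
  have hback : (fun X : Config (n + 1) =>
      (fun X : Config (n + 1) => Ψ (X + fun _ => shiftVec (ε * L))) (X - fun _ => shiftVec (ε * L))) = Ψ := by
    funext X
    simp [sub_add_cancel]
  have hk : ∀ k : Fin 3 → ℤ, occupation (n + 1)
      ({x : Space | ∀ j, x j ∈ Set.Ico (ε * L) (L - ε * L)}.indicator fun x =>
          ((Real.sqrt (((1 - 2 * ε) * L) ^ 3))⁻¹ : ℂ) *
            Complex.exp (Complex.I * ↑(2 * Real.pi / ((1 - 2 * ε) * L) * ∑ j, (k j : ℝ) * x j))) Ψ =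
        occupation (n + 1) ((cell ((1 - 2 * ε) * L)).indicator (planeWaveMode ((1 - 2 * ε) * L) k))
          (fun X : Config (n + 1) => Ψ (X + fun _ => shiftVec (ε * L))) := by
    intro k
    rw [innerMode_eq k]
    have h1 := occupation_phase_mul_mode (n + 1)
      (fun x => (cell ((1 - 2 * ε) * L)).indicator (planeWaveMode ((1 - 2 * ε) * L) k)
        (x - shiftVec (ε * L))) Ψ
      (Complex.norm_exp_ofReal_mul_I (2 * Real.pi / ((1 - 2 * ε) * L) * ∑ j, (k j : ℝ) * (ε * L)))
    have h2 := occupation_translate (n + 1)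
      ((cell ((1 - 2 * ε) * L)).indicator (planeWaveMode ((1 - 2 * ε) * L) k))
      (fun X : Config (n + 1) => Ψ (X + fun _ => shiftVec (ε * L))) (shiftVec (ε * L))
    rw [hback] at h2
    exact h1.trans h2
  simp_rw [hk]
  rw [tsum_occupation_cellMode_eq hL' hΨ'c]
  congr 1
  have hG := lintegral_add_right_eq_self (μ := (volume : Measure (Config (n + 1))))
    (fun X => {x : Space | ∀ j, x j ∈ Set.Ico (ε * L) (L - ε * L)}.indicator
      (fun _ => (1 : ℝ≥0∞)) (X 0) * (‖Ψ X‖₊ : ℝ≥0∞) ^ 2) (fun _ => shiftVec (ε * L))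
  rw [← hG]
  refine lintegral_congr fun X => ?_
  simp only [Pi.add_apply]
  congr 1
  have hiff : (∀ j, (X 0 + shiftVec (ε * L)) j ∈ Set.Ico (ε * L) (L - ε * L)) ↔
      X 0 ∈ cell ((1 - 2 * ε) * L) := by
    rw [mem_innerIco_iff, add_sub_cancel_right]
  by_cases hX : X 0 ∈ cell ((1 - 2 * ε) * L)
  · rw [Set.indicator_of_mem hX, Set.indicator_of_mem
      (show X 0 + shiftVec (ε * L) ∈ {x : Space | ∀ j, x j ∈ Set.Ico (ε * L) (L - ε * L)} from hiff.2 hX)]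
  · rw [Set.indicator_of_notMem hX, Set.indicator_of_notMem
      (show X 0 + shiftVec (ε * L) ∉ {x : Space | ∀ j, x j ∈ Set.Ico (ε * L) (L - ε * L)} from
        fun h => hX (hiff.1 h))]

end Summit.AtomisticToContinuum.BoseEinsteinCondensation.Cruxes.BecDepletionCounting.TranslateTracedParseval


/-! ## Part 2 — TransferProof.lean -/

noncomputable section

open MeasureTheory Complex WithLp
open scoped ENNReal NNReal ComplexConjugate BigOperators

namespace Summit.AtomisticToContinuum.BoseEinsteinCondensation.Cruxes.BecDepletionCounting.TranslateTracedParseval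

open Literature.MathematicalPhysics.QuantumManyBody.BoseGas

/-- Pairing with an indicator-cut mode = restricted pairing. -/
theorem integral_conj_indicator_mul' {s : Set Space} (hs : MeasurableSet s) (φ G : Space → ℂ) :
    ∫ x, conj (s.indicator φ x) * G x = ∫ x in s, conj (φ x) * G x := by
  rw [← integral_indicator hs]
  refine integral_congr_ae (Filter.Eventually.of_forall fun x => ?_)
  by_cases hx : x ∈ s
  · simp [Set.indicator_of_mem hx]
  · simp [Set.indicator_of_notMem hx]

/-- `‖(c:ℂ) z‖₊² = ofReal(c²) ‖z‖₊²` for `c ≥ 0`. -/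
theorem ennorm_real_mul_sq' (c : ℝ) (hc : 0 ≤ c) (z : ℂ) :
    ((‖(c : ℂ) * z‖₊ : ℝ≥0∞)) ^ 2 = ENNReal.ofReal (c ^ 2) * (‖z‖₊ : ℝ≥0∞) ^ 2 := by
  rw [nnnorm_mul, Complex.nnnorm_real, ENNReal.coe_mul, mul_pow, ENNReal.ofReal_pow hc]
  congr 2
  rw [← enorm_eq_nnnorm, ← ofReal_norm, Real.norm_of_nonneg hc]

/-- Parallelogram-type bound `‖t - b‖² ≤ 2‖t‖² + 2‖b‖²`. -/
theorem norm_sub_sq_le_two (t b : ℂ) : ‖t - b‖ ^ 2 ≤ 2 * ‖t‖ ^ 2 + 2 * ‖b‖ ^ 2 := by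
  have h := norm_sub_le t b
  have hsq : ‖t - b‖ ^ 2 ≤ (‖t‖ + ‖b‖) ^ 2 := by
    rw [sq, sq]; exact mul_self_le_mul_self (norm_nonneg _) h
  nlinarith [sq_nonneg (‖t‖ - ‖b‖)]

/-- The half-open inner cube. -/
def innerIco (L ε : ℝ) : Set Space := {x : Space | ∀ j, x j ∈ Set.Ico (ε * L) (L - ε * L)}

theorem measurableSet_innerIco (L ε : ℝ) : MeasurableSet (innerIco L ε) := by
  have : innerIco L ε = ⋂ j : Fin 3, (fun x : Space => x j) ⁻¹' Set.Ico (ε * L) (L - ε * L) := by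
    ext x; simp [innerIco]
  rw [this]
  exact MeasurableSet.iInter fun j => measurableSet_Ico.preimage (by fun_prop)

theorem innerIco_subset_box {L ε : ℝ} (hL : 0 < L) (hε : 0 < ε) : innerIco L ε ⊆ box L := by
  intro x hx k
  have h1 := (hx k).1
  have h2 := (hx k).2
  have hεL : 0 < ε * L := mul_pos hε hL
  simp only [box, Set.mem_setOf_eq, Set.mem_Ioo]
  exact ⟨by linarith, by linarith⟩

/-- The constant shift vector `t·𝟙 ∈ ℝ³`. -/
def shiftVec' (t : ℝ) : Space := toLp 2 fun _ => t

@[simp] theorem shiftVec'_apply (t : ℝ) (j : Fin 3) : shiftVec' t j = t := by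
  simp [shiftVec']

theorem innerIco_eq_preimage {L ε : ℝ} :
    innerIco L ε = (fun x : Space => x + (-shiftVec' (ε * L))) ⁻¹' cell ((1 - 2 * ε) * L) := by
  ext x
  simp only [innerIco, cell, Set.mem_setOf_eq, Set.mem_Ico, Set.mem_preimage, PiLp.add_apply,
    PiLp.neg_apply, shiftVec'_apply]
  refine forall_congr' fun j => ?_
  constructor <;> rintro ⟨h1, h2⟩ <;> constructor <;> linarith

/-- `|box L ∖ innerIco| ≤ 6 ε L³`. -/
theorem volume_box_diff_innerIco_le {L ε : ℝ} (hL : 0 < L) (hε : 0 < ε) (hε4 : ε < 1 / 4) :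
    volume (box L \ innerIco L ε) ≤ ENNReal.ofReal (6 * ε * L ^ 3) := by
  have hL' : 0 ≤ (1 - 2 * ε) * L := by nlinarith
  have hS : volume (innerIco L ε) = ENNReal.ofReal (((1 - 2 * ε) * L) ^ 3) := by
    rw [innerIco_eq_preimage, measure_preimage_add_right, volume_cell, ENNReal.ofReal_pow hL']
  rw [measure_diff (innerIco_subset_box hL hε) (measurableSet_innerIco L ε).nullMeasurableSet
      (by rw [hS]; exact ENNReal.ofReal_ne_top), volume_box, hS, ← ENNReal.ofReal_pow hL.le]
  rw [tsub_le_iff_right, ← ENNReal.ofReal_add (by positivity) (by positivity)]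
  refine ENNReal.ofReal_le_ofReal ?_
  have : 6 * ε * L ^ 3 + ((1 - 2 * ε) * L) ^ 3 - L ^ 3 = 4 * ε ^ 2 * (3 - 2 * ε) * L ^ 3 := by ring
  have h32 : 0 < 3 - 2 * ε := by linarith
  nlinarith [mul_pos (mul_pos (mul_pos (by norm_num : (0:ℝ) < 4) (pow_pos hε 2)) h32) (pow_pos hL 3)]

/-- The box lies in the compact closed box (for integrability of continuous slices). -/
theorem box_subset_closedBox (L : ℝ) :
    box L ⊆ (toLp 2 '' Set.univ.pi fun _ : Fin 3 => Set.Icc (0 : ℝ) L : Set Space) := fun x hx =>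
  ⟨ofLp x, fun k _ => ⟨(hx k).1.le, (hx k).2.le⟩, rfl⟩

/-- FIBRE TRANSFER: for a continuous one-body `f`,
`(1-2ε)³ |⟨φ'_0, f⟩|² ≤ 2 |⟨φ₀, f⟩|² + 12 ε ∫ |f|²` (parallelogram + Cauchy–Schwarz on the shell). -/
theorem fibre_transfer {L ε : ℝ} (hL : 0 < L) (hε : 0 < ε) (hε4 : ε < 1 / 4) {f : Space → ℂ}
    (hf : Continuous f) :
    ENNReal.ofReal ((1 - 2 * ε) ^ 3) *
        (‖∫ x, conj ((innerIco L ε).indicator (fun _ => ((Real.sqrt (((1 - 2 * ε) * L) ^ 3))⁻¹ : ℂ)) x) *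
            f x‖₊ : ℝ≥0∞) ^ 2 ≤
      2 * (‖∫ x, conj ((box L).indicator (fun _ => ((Real.sqrt (L ^ 3))⁻¹ : ℂ)) x) * f x‖₊ : ℝ≥0∞) ^ 2 +
        ENNReal.ofReal (12 * ε) * ∫⁻ x, (‖f x‖₊ : ℝ≥0∞) ^ 2 := by
  have hL' : 0 < (1 - 2 * ε) * L := mul_pos (by linarith) hL
  set c' : ℝ := (Real.sqrt (((1 - 2 * ε) * L) ^ 3))⁻¹ with hc'
  set c : ℝ := (Real.sqrt (L ^ 3))⁻¹ with hc
  have hc'0 : 0 ≤ c' := by positivity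
  have hc0 : 0 ≤ c := by positivity
  have hS := measurableSet_innerIco L ε
  have hSB := innerIco_subset_box hL hε
  -- integrability of the continuous slice on the bounded box
  have hint_box : IntegrableOn f (box L) volume :=
    (hf.continuousOn.integrableOn_compact (isCompact_closedBox L)).mono_set (box_subset_closedBox L)
  have hint_S : IntegrableOn f (innerIco L ε) volume := hint_box.mono_set hSB
  have hint_D : IntegrableOn f (box L \ innerIco L ε) volume := hint_box.mono_set Set.diff_subset
  -- the three integrals
  set a : ℂ := ∫ x in innerIco L ε, f x with ha
  set t : ℂ := ∫ x in box L, f x with ht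
  set b : ℂ := ∫ x in box L \ innerIco L ε, f x with hb
  have htab : t = a + b := by
    rw [ha, hb, ← setIntegral_union (Set.disjoint_sdiff_right) (measurableSet_box L |>.diff hS)
      hint_S hint_D, Set.union_diff_cancel hSB]
  have hIA : ∫ x, conj ((innerIco L ε).indicator (fun _ => (c' : ℂ)) x) * f x = (c' : ℂ) * a := by
    rw [integral_conj_indicator_mul' hS, ha, ← integral_const_mul]
    simp [Complex.conj_ofReal]
  have hIB : ∫ x, conj ((box L).indicator (fun _ => (c : ℂ)) x) * f x = (c : ℂ) * t := by
    rw [integral_conj_indicator_mul' (measurableSet_box L), ht, ← integral_const_mul]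
    simp [Complex.conj_ofReal]
  -- the literal casts `(↑√…)⁻¹ : ℂ` are `↑c'`, `↑c`
  have hcast' : ((Real.sqrt (((1 - 2 * ε) * L) ^ 3))⁻¹ : ℂ) = ((c' : ℝ) : ℂ) := by
    rw [hc', Complex.ofReal_inv]
  have hcast : ((Real.sqrt (L ^ 3))⁻¹ : ℂ) = ((c : ℝ) : ℂ) := by
    rw [hc, Complex.ofReal_inv]
  simp_rw [hcast', hcast]
  rw [hIA, hIB, ennorm_real_mul_sq' c' hc'0, ennorm_real_mul_sq' c hc0]
  -- constants: (1-2ε)³ c'² = c²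
  have h12 : 0 < 1 - 2 * ε := by linarith
  have h12ne : (1 - 2 * ε) ≠ 0 := h12.ne'
  have hLne : L ≠ 0 := hL.ne'
  have hcc : (1 - 2 * ε) ^ 3 * c' ^ 2 = c ^ 2 := by
    rw [hc', hc, inv_pow, inv_pow, Real.sq_sqrt (by positivity), Real.sq_sqrt (by positivity)]
    field_simp
    try ring
  have hcL : c ^ 2 * L ^ 3 = 1 := by
    rw [hc, inv_pow, Real.sq_sqrt (by positivity)]
    field_simp
  rw [← mul_assoc, ← ENNReal.ofReal_mul (pow_nonneg h12.le 3), hcc]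
  -- Cauchy–Schwarz on the shell part
  have hbCS : (‖b‖₊ : ℝ≥0∞) ^ 2 ≤ ENNReal.ofReal (6 * ε * L ^ 3) * ∫⁻ x, (‖f x‖₊ : ℝ≥0∞) ^ 2 := by
    have h1 := nnnorm_integral_sq_le_mul_lintegral (volume.restrict (box L \ innerIco L ε))
      (f := f) hf.measurable.aemeasurable
    rw [Measure.restrict_apply_univ] at h1
    refine h1.trans ?_
    exact mul_le_mul' (volume_box_diff_innerIco_le hL hε hε4) (setLIntegral_le_lintegral _ _)
  -- parallelogram in ENNReal
  have hpar : (‖a‖₊ : ℝ≥0∞) ^ 2 ≤ 2 * (‖t‖₊ : ℝ≥0∞) ^ 2 + 2 * (‖b‖₊ : ℝ≥0∞) ^ 2 := by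
    have hreal := norm_sub_sq_le_two t b
    have hab : a = t - b := by rw [htab]; ring
    rw [hab, coe_nnnorm_sq_eq_ofReal, coe_nnnorm_sq_eq_ofReal, coe_nnnorm_sq_eq_ofReal]
    calc ENNReal.ofReal (‖t - b‖ ^ 2) ≤ ENNReal.ofReal (2 * ‖t‖ ^ 2 + 2 * ‖b‖ ^ 2) :=
          ENNReal.ofReal_le_ofReal hreal
      _ = 2 * ENNReal.ofReal (‖t‖ ^ 2) + 2 * ENNReal.ofReal (‖b‖ ^ 2) := by
          rw [ENNReal.ofReal_add (by positivity) (by positivity), ENNReal.ofReal_mul (by norm_num),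
            ENNReal.ofReal_mul (by norm_num), ENNReal.ofReal_ofNat]
  calc ENNReal.ofReal (c ^ 2) * (‖a‖₊ : ℝ≥0∞) ^ 2
      ≤ ENNReal.ofReal (c ^ 2) * (2 * (‖t‖₊ : ℝ≥0∞) ^ 2 + 2 * (‖b‖₊ : ℝ≥0∞) ^ 2) :=
        mul_le_mul_left' hpar _
    _ = 2 * (ENNReal.ofReal (c ^ 2) * (‖t‖₊ : ℝ≥0∞) ^ 2) +
          2 * ENNReal.ofReal (c ^ 2) * (‖b‖₊ : ℝ≥0∞) ^ 2 := by ring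
    _ ≤ 2 * (ENNReal.ofReal (c ^ 2) * (‖t‖₊ : ℝ≥0∞) ^ 2) +
          2 * ENNReal.ofReal (c ^ 2) * (ENNReal.ofReal (6 * ε * L ^ 3) * ∫⁻ x, (‖f x‖₊ : ℝ≥0∞) ^ 2) :=
        by gcongr <;> exact hbCS
    _ = 2 * (ENNReal.ofReal (c ^ 2) * (‖t‖₊ : ℝ≥0∞) ^ 2) +
          ENNReal.ofReal (12 * ε) * ∫⁻ x, (‖f x‖₊ : ℝ≥0∞) ^ 2 := by
        have h12c : (2 : ℝ≥0∞) * ENNReal.ofReal (c ^ 2) * ENNReal.ofReal (6 * ε * L ^ 3) =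
            ENNReal.ofReal (12 * ε) := by
          rw [show (2 : ℝ≥0∞) = ENNReal.ofReal 2 from (ENNReal.ofReal_ofNat 2).symm,
            ← ENNReal.ofReal_mul (by norm_num), ← ENNReal.ofReal_mul (by positivity)]
          congr 1
          rw [show (2 : ℝ) * c ^ 2 * (6 * ε * L ^ 3) = 12 * ε * (c ^ 2 * L ^ 3) by ring, hcL, mul_one]
        congr 1
        rw [← mul_assoc, h12c]

/-- Abstract integration of a fibrewise transfer inequality. -/
theorem lintegral_fibre_transfer {n : ℕ} {F1 F2 G : Config n → ℝ≥0∞} (hG : Measurable G)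
    {A B : ℝ≥0∞} (hA : A ≠ ⊤) (hfib : ∀ Y, A * F1 Y ≤ 2 * F2 Y + B * G Y) (m : ℝ≥0∞) :
    A * (m * ∫⁻ Y, F1 Y) ≤ 2 * (m * ∫⁻ Y, F2 Y) + B * (m * ∫⁻ Y, G Y) := by
  calc A * (m * ∫⁻ Y, F1 Y) = m * ∫⁻ Y, A * F1 Y := by
        rw [lintegral_const_mul' A _ hA]; ring
    _ ≤ m * ∫⁻ Y, (2 * F2 Y + B * G Y) := by
        gcongr with Y
        exact hfib Y
    _ = m * (2 * ∫⁻ Y, F2 Y) + m * (B * ∫⁻ Y, G Y) := by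
        rw [lintegral_add_right _ (hG.const_mul B), lintegral_const_mul' 2 _ (by simp),
          lintegral_const_mul B hG, mul_add]
    _ = 2 * (m * ∫⁻ Y, F2 Y) + B * (m * ∫⁻ Y, G Y) := by ring

/-- SHELL TRANSFER (symmetry-free, second stub of the line):
`(1-2ε)³ · occ(φ'_0)Ψ ≤ 2 · occ(φ₀)Ψ + 12 ε (n+1)` for every trial state, where `φ'_0` is the
normalised constant mode of the half-open inner cube and `φ₀` that of the box. -/
theorem shellTransfer {n : ℕ} {L ε : ℝ} (hL : 0 < L) (hε : 0 < ε) (hε4 : ε < 1 / 4)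
    (Ψ : TrialState (n + 1) L) :
    ENNReal.ofReal ((1 - 2 * ε) ^ 3) *
        occupation (n + 1)
          ({x : Space | ∀ j, x j ∈ Set.Ico (ε * L) (L - ε * L)}.indicator
            fun _ => ((Real.sqrt (((1 - 2 * ε) * L) ^ 3))⁻¹ : ℂ)) Ψ.ψ ≤
      2 * occupation (n + 1) ((box L).indicator fun _ => ((Real.sqrt (L ^ 3))⁻¹ : ℂ)) Ψ.ψ +
        ENNReal.ofReal (12 * ε) * ((n : ℝ≥0∞) + 1) := by
  have hΨc : Continuous Ψ.ψ := Ψ.contDiff.continuous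
  have hslice : ∀ Y : Config n, Continuous fun x : Space => Ψ.ψ (Matrix.vecCons x Y) := fun Y =>
    hΨc.comp (continuous_id.matrixVecCons continuous_const)
  have hG : Measurable fun Y : Config n => ∫⁻ x, (‖Ψ.ψ (Matrix.vecCons x Y)‖₊ : ℝ≥0∞) ^ 2 := by
    have hj : Measurable (Function.uncurry fun (Y : Config n) (x : Space) =>
        (‖Ψ.ψ (Matrix.vecCons x Y)‖₊ : ℝ≥0∞) ^ 2) := by
      show Measurable fun p : Config n × Space => (‖Ψ.ψ (Matrix.vecCons p.2 p.1)‖₊ : ℝ≥0∞) ^ 2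
      exact (hΨc.measurable.comp (measurable_vecCons.comp measurable_swap)).nnnorm
        |>.coe_nnreal_ennreal.pow_const _
    exact hj.lintegral_prod_right'
  have htot : ∫⁻ Y : Config n, ∫⁻ x, (‖Ψ.ψ (Matrix.vecCons x Y)‖₊ : ℝ≥0∞) ^ 2 = 1 := by
    have hF : Measurable fun X : Config (n + 1) => (‖Ψ.ψ X‖₊ : ℝ≥0∞) ^ 2 :=
      hΨc.measurable.nnnorm.coe_nnreal_ennreal.pow_const _
    have hAE : AEMeasurable (Function.uncurry fun (x : Space) (Y : Config n) =>
        (‖Ψ.ψ (Matrix.vecCons x Y)‖₊ : ℝ≥0∞) ^ 2) (volume.prod volume) :=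
      (hF.comp measurable_vecCons).aemeasurable
    rw [← lintegral_lintegral_swap hAE, lintegral_lintegral_vecCons hF, Ψ.norm_eq]
  show ENNReal.ofReal ((1 - 2 * ε) ^ 3) * occupation (n + 1) ((innerIco L ε).indicator
      fun _ => ((Real.sqrt (((1 - 2 * ε) * L) ^ 3))⁻¹ : ℂ)) Ψ.ψ ≤ _
  simp only [occupation]
  refine (lintegral_fibre_transfer hG ENNReal.ofReal_ne_top
    (fun Y => fibre_transfer hL hε hε4 (hslice Y)) _).trans_eq ?_
  rw [htot, mul_one]

end Summit.AtomisticToContinuum.BoseEinsteinCondensation.Cruxes.BecDepletionCounting.TranslateTracedParseval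


/-! ## Part 3 — composition to the crux by name -/

noncomputable section

namespace Summit.AtomisticToContinuum.BoseEinsteinCondensation.Cruxes.BecDepletionCounting.TranslateTracedParseval

open MeasureTheory Complex WithLp Filter
open scoped ENNReal NNReal ComplexConjugate BigOperators
open Literature.MathematicalPhysics.QuantumManyBody.BoseGas

/-- The open inner cube of the crux. -/
def innerIoo (L ε : ℝ) : Set Space := {x : Space | ∀ j, x j ∈ Set.Ioo (ε * L) (L - ε * L)}

theorem innerIoo_eq_preimage {L ε : ℝ} :
    innerIoo L ε = (fun x : Space => x + (-shiftVec' (ε * L))) ⁻¹' box ((1 - 2 * ε) * L) := by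
  ext x
  simp only [innerIoo, box, Set.mem_setOf_eq, Set.mem_Ioo, Set.mem_preimage, PiLp.add_apply,
    PiLp.neg_apply, shiftVec'_apply]
  refine forall_congr' fun j => ?_
  constructor <;> rintro ⟨h1, h2⟩ <;> constructor <;> linarith

theorem innerIoo_subset_innerIco (L ε : ℝ) : innerIoo L ε ⊆ innerIco L ε := fun x hx j =>
  ⟨(hx j).1.le, (hx j).2⟩

/-- `Λ'(open) = S(half-open)` almost everywhere (faces are null): pull back `box =ᵐ cell` along
the measure-preserving translation. -/
theorem innerIoo_ae_eq_innerIco (L ε : ℝ) : innerIoo L ε =ᵐ[volume] innerIco L ε := by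
  rw [innerIoo_eq_preimage, innerIco_eq_preimage]
  exact (measurePreserving_add_right volume (-shiftVec' (ε * L))).quasiMeasurePreserving.preimage_ae_eq
    (Literature.MathematicalPhysics.QuantumManyBody.NeumannBox.box_ae_eq_cell _)

/-- Splitting `k = 0` off an `ℝ≥0∞`-valued sum over `ℤ³`. -/
theorem tsum_eq_zero_add_tsum_ne_zero (f : (Fin 3 → ℤ) → ℝ≥0∞) :
    ∑' k, f k = f 0 + ∑' k : {k : Fin 3 → ℤ // k ≠ 0}, f k.1 := by
  rw [ENNReal.tsum_eq_add_tsum_ite 0]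
  congr 1
  rw [show (∑' k : {k : Fin 3 → ℤ // k ≠ 0}, f k.1) =
      ∑' k : ({k | k ≠ 0} : Set (Fin 3 → ℤ)), f k from rfl, tsum_subtype]
  refine tsum_congr fun k => ?_
  by_cases hk : k = 0
  · simp [hk]
  · rw [Set.indicator_of_mem (show k ∈ {k : Fin 3 → ℤ | k ≠ 0} from hk)]
    simp [hk]

/-- The real arithmetic of the counting step (birth's `zeroMode_lower_arith`, with the symmetry-free
transfer term `12 ε N` in place of `12 ε N_shell`, compensated by `ε ≤ s/128`). -/
theorem zeroMode_lower_arith' {O O' S M : ℝ≥0∞} {N : ℕ} {C ε s θ : ℝ}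
    (hε0 : 0 < ε) (hε8 : ε ≤ 1 / 8) (hs0 : 0 < s) (hθ0 : 0 ≤ θ) (hθs : θ ≤ 1 - s)
    (hC0 : 0 < C) (hCε : C * ε ≤ s / 16) (hεs : ε ≤ s / 128)
    (h1 : O' + S + M = (N : ℝ≥0∞))
    (h2 : S ≤ ENNReal.ofReal (θ * N))
    (h3 : M ≤ ENNReal.ofReal (C * ε * N))
    (h4 : ENNReal.ofReal ((1 - 2 * ε) ^ 3) * O' ≤ 2 * O + ENNReal.ofReal (12 * ε) * (N : ℝ≥0∞)) :
    ENNReal.ofReal (s / 8 * N) ≤ O := by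
  rcases eq_or_ne O ⊤ with hO | hO
  · rw [hO]; exact le_top
  have hO'T : O' ≠ ⊤ := by
    intro h; rw [h, top_add, top_add] at h1; exact ENNReal.top_ne_natCast N h1
  have hST : S ≠ ⊤ := by
    intro h; rw [h, add_top, top_add] at h1; exact ENNReal.top_ne_natCast N h1
  have hMT : M ≠ ⊤ := by
    intro h; rw [h, add_top] at h1; exact ENNReal.top_ne_natCast N h1
  have e1 : O'.toReal + S.toReal + M.toReal = N := by
    have := congrArg ENNReal.toReal h1
    rwa [ENNReal.toReal_add (ENNReal.add_ne_top.2 ⟨hO'T, hST⟩) hMT, ENNReal.toReal_add hO'T hST,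
      ENNReal.toReal_natCast] at this
  have e2 : S.toReal ≤ θ * N := ENNReal.toReal_le_of_le_ofReal (by positivity) h2
  have e3 : M.toReal ≤ C * ε * N := ENNReal.toReal_le_of_le_ofReal (by positivity) h3
  have hM0 : 0 ≤ M.toReal := ENNReal.toReal_nonneg
  have hA0 : 0 ≤ (1 - 2 * ε) ^ 3 := by
    have : 0 ≤ 1 - 2 * ε := by linarith
    positivity
  have h2O : (2 : ℝ≥0∞) * O ≠ ⊤ := ENNReal.mul_ne_top (by norm_num) hO
  have h12N : ENNReal.ofReal (12 * ε) * (N : ℝ≥0∞) ≠ ⊤ :=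
    ENNReal.mul_ne_top ENNReal.ofReal_ne_top (ENNReal.natCast_ne_top N)
  have e4 : (1 - 2 * ε) ^ 3 * O'.toReal ≤ 2 * O.toReal + 12 * ε * N := by
    have := ENNReal.toReal_mono (ENNReal.add_ne_top.2 ⟨h2O, h12N⟩) h4
    rwa [ENNReal.toReal_mul, ENNReal.toReal_ofReal hA0, ENNReal.toReal_add h2O h12N,
      ENNReal.toReal_mul, ENNReal.toReal_mul, ENNReal.toReal_ofReal (by positivity),
      ENNReal.toReal_ofNat, ENNReal.toReal_natCast] at this
  refine ENNReal.ofReal_le_of_le_toReal ?_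
  have hN : (0 : ℝ) ≤ N := Nat.cast_nonneg N
  have hA27 : (27 / 64 : ℝ) ≤ (1 - 2 * ε) ^ 3 := by
    have h34 : (3 / 4 : ℝ) ≤ 1 - 2 * ε := by linarith
    have : (27 / 64 : ℝ) = (3 / 4) ^ 3 := by norm_num
    rw [this]
    exact pow_le_pow_left₀ (by norm_num) h34 3
  generalize hA : (1 - 2 * ε) ^ 3 = A at e4 hA0 hA27
  have hgap : 0 ≤ (N : ℝ) - θ * N - C * ε * N := by
    have : 0 ≤ 1 - θ - C * ε := by linarith
    nlinarith [mul_nonneg hN this]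
  have ho' : (N : ℝ) - θ * N - C * ε * N ≤ O'.toReal := by linarith
  have h5 : A * ((N : ℝ) - θ * N - C * ε * N) ≤ A * O'.toReal := mul_le_mul_of_nonneg_left ho' hA0
  have h7 : (27 / 64 : ℝ) * ((N : ℝ) - θ * N - C * ε * N) ≤ A * ((N : ℝ) - θ * N - C * ε * N) :=
    mul_le_mul_of_nonneg_right hA27 hgap
  have h8 : θ * N ≤ (1 - s) * N := mul_le_mul_of_nonneg_right hθs hN
  have h9 : C * ε * N ≤ s / 16 * N := mul_le_mul_of_nonneg_right hCε hN
  have h10 : ε * N ≤ s / 128 * N := mul_le_mul_of_nonneg_right hεs hN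
  have hsN : 0 ≤ s * N := mul_nonneg hs0.le hN
  nlinarith [h5, h7, h8, h9, h10, hsN, e4]

/-- CORE COUNTING STEP at fixed `n, L, ε` (all analysis done): DEPL on the open inner cube + SHELL ⟹
`occ(φ₀) ≥ (s/8)·N`. -/
theorem counting_core {n : ℕ} {L ε C s θ : ℝ} (hL : 0 < L) (hε0 : 0 < ε) (hε8 : ε ≤ 1 / 8)
    (hs0 : 0 < s) (hθ0 : 0 ≤ θ) (hθs : θ ≤ 1 - s) (hC0 : 0 < C) (hCε : C * ε ≤ s / 16)
    (hεs : ε ≤ s / 128) (Ψ : TrialState (n + 1) L)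
    (hD : ∑' k : {k : Fin 3 → ℤ // k ≠ 0}, occupation (n + 1)
        ((innerIoo L ε).indicator fun x => ((Real.sqrt (((1 - 2 * ε) * L) ^ 3))⁻¹ : ℂ) *
          Complex.exp (Complex.I * ↑(2 * Real.pi / ((1 - 2 * ε) * L) * ∑ j, (k.1 j : ℝ) * x j))) Ψ.ψ
        ≤ ENNReal.ofReal (θ * ((n + 1 : ℕ) : ℝ)))
    (hS : ∑ i : Fin (n + 1), ∫⁻ X, (innerIoo L ε)ᶜ.indicator (fun _ => (1 : ℝ≥0∞)) (X i) *
        (‖Ψ.ψ X‖₊ : ℝ≥0∞) ^ 2 ≤ ENNReal.ofReal (C * ε * ((n + 1 : ℕ) : ℝ))) :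
    ENNReal.ofReal (s / 8 * ((n + 1 : ℕ) : ℝ)) ≤
      occupation (n + 1) ((box L).indicator fun _ => ((Real.sqrt (L ^ 3))⁻¹ : ℂ)) Ψ.ψ := by
  have hε4 : ε < 1 / 4 := by linarith
  have hε2 : ε < 1 / 2 := by linarith
  have hΨc : Continuous Ψ.ψ := Ψ.contDiff.continuous
  have hmeasS : Measurable fun X : Config (n + 1) =>
      (innerIco L ε).indicator (fun _ => (1 : ℝ≥0∞)) (X 0) * (‖Ψ.ψ X‖₊ : ℝ≥0∞) ^ 2 :=
    ((measurable_const.indicator (measurableSet_innerIco L ε)).comp (measurable_pi_apply 0)).mul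
      (hΨc.measurable.nnnorm.coe_nnreal_ennreal.pow_const _)
  -- (1) DEPL transferred to the half-open cube (modes agree a.e.)
  have hD' : ∑' k : {k : Fin 3 → ℤ // k ≠ 0}, occupation (n + 1)
      ((innerIco L ε).indicator fun x => ((Real.sqrt (((1 - 2 * ε) * L) ^ 3))⁻¹ : ℂ) *
        Complex.exp (Complex.I * ↑(2 * Real.pi / ((1 - 2 * ε) * L) * ∑ j, (k.1 j : ℝ) * x j))) Ψ.ψ
      ≤ ENNReal.ofReal (θ * ((n + 1 : ℕ) : ℝ)) :=
    (tsum_congr fun k => occupation_congr_ae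
      (indicator_ae_eq_of_ae_eq_set (innerIoo_ae_eq_innerIco L ε).symm) _).trans_le hD
  -- (2) the inner-cube sum rule, `k = 0` split off, zero mode = constant mode
  have hsum : occupation (n + 1)
        ((innerIco L ε).indicator fun _ => ((Real.sqrt (((1 - 2 * ε) * L) ^ 3))⁻¹ : ℂ)) Ψ.ψ +
      ∑' k : {k : Fin 3 → ℤ // k ≠ 0}, occupation (n + 1)
        ((innerIco L ε).indicator fun x => ((Real.sqrt (((1 - 2 * ε) * L) ^ 3))⁻¹ : ℂ) *
          Complex.exp (Complex.I * ↑(2 * Real.pi / ((1 - 2 * ε) * L) * ∑ j, (k.1 j : ℝ) * x j))) Ψ.ψ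
      = ((n : ℝ≥0∞) + 1) * ∫⁻ X : Config (n + 1),
          (innerIco L ε).indicator (fun _ => (1 : ℝ≥0∞)) (X 0) * (‖Ψ.ψ X‖₊ : ℝ≥0∞) ^ 2 := by
    have h := tsum_occupation_innerMode_eq (ε := ε) hL hε2 hΨc
    rw [tsum_eq_zero_add_tsum_ne_zero] at h
    simp only [Pi.zero_apply, Int.cast_zero, zero_mul, Finset.sum_const_zero, mul_zero,
      Complex.ofReal_zero, Complex.exp_zero, mul_one] at h
    exact h
  -- (3) mass split `(n+1)·P(x₀ ∈ S) + (n+1)·P(x₀ ∉ S) = n+1`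
  have hmass : (((n : ℝ≥0∞) + 1) * ∫⁻ X : Config (n + 1),
          (innerIco L ε).indicator (fun _ => (1 : ℝ≥0∞)) (X 0) * (‖Ψ.ψ X‖₊ : ℝ≥0∞) ^ 2) +
        ((n : ℝ≥0∞) + 1) * ∫⁻ X : Config (n + 1),
          (innerIco L ε)ᶜ.indicator (fun _ => (1 : ℝ≥0∞)) (X 0) * (‖Ψ.ψ X‖₊ : ℝ≥0∞) ^ 2 =
      ((n + 1 : ℕ) : ℝ≥0∞) := by
    rw [← mul_add, ← lintegral_add_left hmeasS]
    rw [lintegral_congr fun X => by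
      rw [← add_mul, Set.indicator_self_add_compl_apply, one_mul]]
    rw [Ψ.norm_eq, mul_one, Nat.cast_succ]
  -- (4) shell by Bose symmetry + monotonicity `1_{Sᶜ} ≤ 1_{Λ'ᶜ}`
  have hperm : ∀ i : Fin (n + 1),
      ∫⁻ X : Config (n + 1), (innerIco L ε)ᶜ.indicator (fun _ => (1 : ℝ≥0∞)) (X i) *
          (‖Ψ.ψ X‖₊ : ℝ≥0∞) ^ 2 =
        ∫⁻ X : Config (n + 1), (innerIco L ε)ᶜ.indicator (fun _ => (1 : ℝ≥0∞)) (X 0) *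
          (‖Ψ.ψ X‖₊ : ℝ≥0∞) ^ 2 := by
    intro i
    refine (lintegral_congr fun X => ?_).trans (lintegral_comp_perm (Equiv.swap 0 i)
      (fun X : Config (n + 1) => (innerIco L ε)ᶜ.indicator (fun _ => (1 : ℝ≥0∞)) (X 0) *
        (‖Ψ.ψ X‖₊ : ℝ≥0∞) ^ 2))
    simp only [Function.comp_apply, Equiv.swap_apply_left, Ψ.symm]
  have hM : ((n : ℝ≥0∞) + 1) * ∫⁻ X : Config (n + 1),
        (innerIco L ε)ᶜ.indicator (fun _ => (1 : ℝ≥0∞)) (X 0) * (‖Ψ.ψ X‖₊ : ℝ≥0∞) ^ 2 ≤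
      ENNReal.ofReal (C * ε * ((n + 1 : ℕ) : ℝ)) := by
    calc ((n : ℝ≥0∞) + 1) * ∫⁻ X : Config (n + 1),
          (innerIco L ε)ᶜ.indicator (fun _ => (1 : ℝ≥0∞)) (X 0) * (‖Ψ.ψ X‖₊ : ℝ≥0∞) ^ 2
        = ∑ i : Fin (n + 1), ∫⁻ X : Config (n + 1),
            (innerIco L ε)ᶜ.indicator (fun _ => (1 : ℝ≥0∞)) (X 0) * (‖Ψ.ψ X‖₊ : ℝ≥0∞) ^ 2 := by
          rw [Finset.sum_const, Finset.card_univ, Fintype.card_fin, nsmul_eq_mul, Nat.cast_succ]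
      _ = ∑ i : Fin (n + 1), ∫⁻ X : Config (n + 1),
            (innerIco L ε)ᶜ.indicator (fun _ => (1 : ℝ≥0∞)) (X i) * (‖Ψ.ψ X‖₊ : ℝ≥0∞) ^ 2 :=
          Finset.sum_congr rfl fun i _ => (hperm i).symm
      _ ≤ ∑ i : Fin (n + 1), ∫⁻ X : Config (n + 1),
            (innerIoo L ε)ᶜ.indicator (fun _ => (1 : ℝ≥0∞)) (X i) * (‖Ψ.ψ X‖₊ : ℝ≥0∞) ^ 2 := by
          refine Finset.sum_le_sum fun i _ => lintegral_mono fun X => mul_le_mul_right'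
            (Set.indicator_le_indicator_of_subset
              (Set.compl_subset_compl.2 (innerIoo_subset_innerIco L ε)) (fun _ => ?_) _) _
          exact zero_le_one
      _ ≤ _ := hS
  -- (5) the shell transfer
  have hT : ENNReal.ofReal ((1 - 2 * ε) ^ 3) * occupation (n + 1)
        ((innerIco L ε).indicator fun _ => ((Real.sqrt (((1 - 2 * ε) * L) ^ 3))⁻¹ : ℂ)) Ψ.ψ ≤
      2 * occupation (n + 1) ((box L).indicator fun _ => ((Real.sqrt (L ^ 3))⁻¹ : ℂ)) Ψ.ψ +
        ENNReal.ofReal (12 * ε) * ((n + 1 : ℕ) : ℝ≥0∞) := by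
    have h := shellTransfer hL hε0 hε4 Ψ
    rw [← Nat.cast_succ] at h
    exact h
  -- (6) arithmetic
  have h1 := (congrArg (fun t => t + ((n : ℝ≥0∞) + 1) * ∫⁻ X : Config (n + 1),
      (innerIco L ε)ᶜ.indicator (fun _ => (1 : ℝ≥0∞)) (X 0) * (‖Ψ.ψ X‖₊ : ℝ≥0∞) ^ 2) hsum).trans
    hmass
  exact zeroMode_lower_arith' hε0 hε8 hs0 hθ0 hθs hC0 hCε hεs h1 hD' hM hT

/-- **The crux, by name.** `BECInfraredBound.BecDepletionCounting` holds (unconditionally: it is a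
deterministic counting implication). Margin `ε = min(1/8, s/(16C), s/128)`, `s = 1 − max θ 0`,
constant `c = s/8`; both hypotheses are used (DEPL at `hD`, SHELL at `hS`). -/
theorem becDepletionCounting :
    Summit.AtomisticToContinuum.BoseEinsteinCondensation.Theses.BECInfraredBound.BecDepletionCounting := by
  intro v hv hD hS
  obtain ⟨θ, hθ1, HD⟩ := hD
  obtain ⟨C, hC0, HS⟩ := hS
  obtain ⟨s, hs0, hθs, hθs'⟩ : ∃ s : ℝ, 0 < s ∧ max θ 0 ≤ 1 - s ∧ s ≤ 1 :=
    ⟨1 - max θ 0, by have := max_lt hθ1 one_pos; linarith, le_of_eq (by ring),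
      by have := le_max_right θ 0; linarith⟩
  obtain ⟨ε, hε0, hε8, hCε, hεs⟩ : ∃ ε : ℝ, 0 < ε ∧ ε ≤ 1 / 8 ∧ C * ε ≤ s / 16 ∧ ε ≤ s / 128 := by
    refine ⟨min (min (1 / 8) (s / (16 * C))) (s / 128), ?_, ?_, ?_, min_le_right _ _⟩
    · exact lt_min (lt_min (by norm_num) (by positivity)) (by positivity)
    · exact (min_le_left _ _).trans (min_le_left _ _)
    · calc C * min (min (1 / 8) (s / (16 * C))) (s / 128) ≤ C * (s / (16 * C)) :=
            mul_le_mul_of_nonneg_left ((min_le_left _ _).trans (min_le_right _ _)) hC0.le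
        _ = s / 16 := by field_simp
  have hε4 : ε < 1 / 4 := by linarith
  obtain ⟨ρ₁, hρ₁, H1⟩ := HD ε hε0 hε4
  obtain ⟨ρ₂, hρ₂, H2⟩ := HS ε hε0 hε4
  refine ⟨min ρ₁ ρ₂, lt_min hρ₁ hρ₂, fun ρ hρ hρlt => ⟨s / 8, by positivity, ?_⟩⟩
  filter_upwards [H1 ρ hρ (lt_of_lt_of_le hρlt (min_le_left _ _)),
    H2 ρ hρ (lt_of_lt_of_le hρlt (min_le_right _ _)), Filter.eventually_ge_atTop 1]
    with N hN1 hN2 hNpos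
  obtain ⟨δ₁, hδ₁, HΨ1⟩ := hN1
  obtain ⟨δ₂, hδ₂, HΨ2⟩ := hN2
  refine ⟨min δ₁ δ₂, lt_min hδ₁ hδ₂, fun Ψ hΨ => ?_⟩
  have hΨ1 := HΨ1 Ψ (hΨ.trans (add_le_add le_rfl (min_le_left _ _)))
  have hΨ2 := HΨ2 Ψ (hΨ.trans (add_le_add le_rfl (min_le_right _ _)))
  obtain ⟨n, rfl⟩ : ∃ n, N = n + 1 := Nat.exists_eq_succ_of_ne_zero (by omega)
  have hL : 0 < sideLength ρ (n + 1) :=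
    Real.rpow_pos_of_pos (div_pos (by exact_mod_cast hNpos) hρ) _
  have hθN : ENNReal.ofReal (θ * ((n + 1 : ℕ) : ℝ)) ≤ ENNReal.ofReal (max θ 0 * ((n + 1 : ℕ) : ℝ)) :=
    ENNReal.ofReal_le_ofReal (mul_le_mul_of_nonneg_right (le_max_left θ 0) (Nat.cast_nonneg _))
  exact counting_core hL hε0 hε8 hs0 (le_max_right θ 0) hθs hC0 hCε hεs Ψ (hΨ1.trans hθN) hΨ2

end Summit.AtomisticToContinuum.BoseEinsteinCondensation.Cruxes.BecDepletionCounting.TranslateTracedParseval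

end
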